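/-
Origin: expansion seat `planner-pub-hodgecm-pv15-g2-0`, handover #9 2026-08-18T07:16:45Z (`HOME/pub-hodgecm-pv15-g2/lean/Pv15g2/TorusUnfold.lean`, md5 39e8b7c8, 116 lines);
landed by the gen-7 packager in gate run 25 as `HodgeCM/Automorphic/TorusUnfold.lean` (verbatim).
-/
/-
Origin: HOME/pub-hodgecm-pv15-g2/lean/Pv15g2/TorusUnfold.lean — session planner-pub-hodgecm-pv15-g2-0
(unit pub-hodgecm-pv15-g2, DAG-NODE PROVER #15 gen 2; lineage N23a → N23c, the β-unfolding identification of GAPS pv15g2-K6).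
Intended final place (packager's call): `HodgeCM/Automorphic/TorusUnfold.lean`.
NEW, ADDITIVE LEAF; imports the LANDED `HodgeCM.PerL34.PseudoEisenstein` (gen 1, run 19; only for the weight `wt`) —
otherwise Mathlib.  KIND: KERNEL — nothing cited, nothing posited, no `Universe`.
-/
import Summits.HodgeConjecture.HodgeCM.PerL34.PseudoEisenstein_3

/-!
# The β-unfolding of the torus quotient (PerL v5 l. 405: `β ∈ C_c(T(𝔸))`, `Σ_{γ ∈ T(L₀)} β(γt) = 1`)

PerL builds the pseudo-Eisenstein series with a cut-off `β` that is a `T(L₀)`-partition of unity on `T(𝔸)` precisely so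
that β-weighted integrals over `T(𝔸)` ARE integrals over the compact quotient `[T] = T(L₀)\T(𝔸)`.  This file proves that
identification at kernel level, in Mathlib generality (Mathlib's unfolding trick
`QuotientGroup.integral_mul_eq_integral_automorphize_mul`, specialised to an automorphization equal to `1`):

* `integral_mul_eq_integral_quotient` — for a subgroup `Λ ≤ T` (countable) with fundamental domain `𝓕` (for `Λ.op`), a
  right-invariant measure `ν`, an integrable weight `β` with `∑' a : Λ.op, β(t·a) = 1`, and a bounded measurable `g` on `T ⧸ Λ`:
  `∫_T g(π t) β(t) dν = ∫_{T ⧸ Λ} g dν_𝓕`, `ν_𝓕 = map π (ν|𝓕)`;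
* `betaPeriod_eq_quotientPeriod` — the β-weighted toric period of GAPS pv15g2-K6 / `UnfoldAnnihilation` equals the
  genuine period over the compact model `K := T ⧸ Λ`, `μK := ν_𝓕`:
  `∫_T β(t) conj χ(t) y(pt t) dν = ∫_K resy(k) conj ξ(k) dμK` whenever `resy ∘ π = y ∘ pt` and `ξ ∘ π = χ`
  (a `Λ`-invariant observable `y ∘ pt` and an automorphic character `χ`).  With pv06-g3's
  `PT ξ := periodCLM μK ξ ∘ res` (`= F ↦ ∫ F conj ξ dμK`) this is exactly the hypothesis `hP` of
  `KernelTorusCarrier.unfold_holds` (file `KernelModelUnfold`), so for the compact model `K = T ⧸ Λ` of `[T]` the field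
  `unfold` [AX12(ii)] holds with NO residual identification.
-/

set_option autoImplicit false

noncomputable section

open MeasureTheory Set Filter Function
open scoped ENNReal ComplexConjugate

attribute [-instance] Quotient.instMeasurableSpace

namespace HodgeCM

namespace TorusUnfold

open HodgeCM.PerL34.N23a

variable {T : Type*} [Group T] [MeasurableSpace T] [TopologicalSpace T] [IsTopologicalGroup T] [BorelSpace T]
  {ν : Measure T} [ν.IsMulRightInvariant] {Λ : Subgroup T} [Countable Λ]
  [MeasurableSpace (T ⧸ Λ)] [BorelSpace (T ⧸ Λ)]
  {𝓕 : Set T} (h𝓕 : IsFundamentalDomain Λ.op 𝓕 ν)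

omit [MeasurableSpace T] [TopologicalSpace T] [IsTopologicalGroup T] [BorelSpace T] [Countable Λ]
  [MeasurableSpace (T ⧸ Λ)] [BorelSpace (T ⧸ Λ)] in
/-- The automorphization of a `Λ`-partition of unity is the constant `1`. -/
theorem automorphize_eq_one (β : T → ℂ) (hβ1 : ∀ t : T, ∑' a : Λ.op, β (a • t) = 1) :
    (QuotientGroup.automorphize β : T ⧸ Λ → ℂ) = 1 := by
  funext q
  induction q using QuotientGroup.induction_on with
  | H t => exact hβ1 t

include h𝓕 in
/-- **β-unfolding**: `∫_T g(π t) β(t) dν = ∫_{T ⧸ Λ} g dν_𝓕` for `β` a `Λ`-partition of unity (integrable) and `g` bounded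
measurable on the quotient. -/
theorem integral_mul_eq_integral_quotient (β : T → ℂ) (hβi : Integrable β ν)
    (hβ1 : ∀ t : T, ∑' a : Λ.op, β (a • t) = 1)
    (g : T ⧸ Λ → ℂ) (hg : AEStronglyMeasurable g (Measure.map (QuotientGroup.mk : T → T ⧸ Λ) (ν.restrict 𝓕)))
    (hgb : essSup (fun q => (‖g q‖ₑ : ℝ≥0∞)) (Measure.map (QuotientGroup.mk : T → T ⧸ Λ) (ν.restrict 𝓕)) ≠ ∞) :
    ∫ t, g (QuotientGroup.mk t) * β t ∂ν = ∫ q, g q ∂(Measure.map (QuotientGroup.mk : T → T ⧸ Λ) (ν.restrict 𝓕)) := by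
  have h1 : (QuotientGroup.automorphize β : T ⧸ Λ → ℂ) = 1 := automorphize_eq_one β hβ1
  have hF : AEStronglyMeasurable (QuotientGroup.automorphize β)
      (Measure.map (QuotientGroup.mk : T → T ⧸ Λ) (ν.restrict 𝓕)) := by
    rw [h1]
    exact aestronglyMeasurable_const
  rw [QuotientGroup.integral_mul_eq_integral_automorphize_mul h𝓕 hβi hg hgb hF]
  simp only [h1, Pi.one_apply, mul_one]

omit [MeasurableSpace T] [IsTopologicalGroup T] [BorelSpace T] [Countable Λ] [BorelSpace (T ⧸ Λ)] in
/-- A continuous function on a compact quotient is essentially bounded for any measure. -/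
theorem essSup_enorm_ne_top [CompactSpace (T ⧸ Λ)] (μ : Measure (T ⧸ Λ)) (g : C(T ⧸ Λ, ℂ)) :
    essSup (fun q => (‖g q‖ₑ : ℝ≥0∞)) μ ≠ ∞ := by
  refine ne_top_of_le_ne_top ENNReal.coe_ne_top (essSup_le_of_ae_le (‖g‖₊ : ℝ≥0∞) (Eventually.of_forall fun q => ?_))
  have h : ‖g q‖ ≤ ‖g‖ := g.norm_coe_le_norm q
  change ‖g q‖ₑ ≤ (‖g‖₊ : ℝ≥0∞)
  rw [enorm_eq_nnnorm]
  exact_mod_cast h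

include h𝓕 in
/-- **The β-weighted toric period IS the period over the compact quotient** (GAPS pv15g2-K6's identification, kernel):
for `β` real, continuous, compactly supported with `∑' a : Λ.op, β(t·a) = 1`, `χ` continuous, `pt : T → Q`, `y : Q → ℂ`, and any
`resy`, `ξ` on the compact quotient `T ⧸ Λ` with `resy (π t) = y (pt t)`, `ξ (π t) = χ t` (continuous):
`∫_T β(t) conj χ(t) y(pt t) dν = ∫_{T ⧸ Λ} resy(k) conj ξ(k) dν_𝓕`. -/
theorem betaPeriod_eq_quotientPeriod [CompactSpace (T ⧸ Λ)]
    (β : T → ℝ) (hβ : Continuous β) (hβs : HasCompactSupport β) [IsFiniteMeasureOnCompacts ν]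
    (hβ1 : ∀ t : T, ∑' a : Λ.op, (β (a • t) : ℂ) = 1)
    (χ : T → ℂ) {Q : Type*} (pt : T → Q) (y : Q → ℂ)
    (resy : C(T ⧸ Λ, ℂ)) (hres : ∀ t, resy (QuotientGroup.mk t) = y (pt t))
    (ξ : C(T ⧸ Λ, ℂ)) (hξ : ∀ t, ξ (QuotientGroup.mk t) = χ t) :
    ∫ t, wt β (star χ) t * y (pt t) ∂ν
      = ∫ k, resy k * conj (ξ k) ∂(Measure.map (QuotientGroup.mk : T → T ⧸ Λ) (ν.restrict 𝓕)) := by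
  -- the bounded measurable observable `g := resy · conj ξ` on the quotient
  set g : C(T ⧸ Λ, ℂ) := resy * (ContinuousMap.mk (fun k => conj (ξ k))
    (Complex.continuous_conj.comp ξ.continuous)) with hg
  have hgq : ∀ k, g k = resy k * conj (ξ k) := fun k => rfl
  have key := integral_mul_eq_integral_quotient h𝓕 (fun t => (β t : ℂ)) 
    ((Complex.continuous_ofReal.comp hβ).integrable_of_hasCompactSupport (hβs.comp_left Complex.ofReal_zero)) hβ1 g
    g.continuous.aestronglyMeasurable (essSup_enorm_ne_top _ g)
  simp only [hgq] at key
  rw [← key]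
  congr 1
  ext t
  rw [hres, hξ, wt, Pi.star_apply, Complex.star_def]
  ring

end TorusUnfold

end HodgeCM

end
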